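import Summits.PneNP.PneNP.Theorems.SzkEntropyPeaThreeNotInPSocketAffineBit
import Literature.Computability.Complexity.CodeFPArith
import Literature.Computability.Complexity.CodeFPBudgets
import Literature.Computability.Complexity.CodeFPListKit
import Literature.Computability.Complexity.CodeFPTableKit
import HarnessLib

/-!
# Route SzkEntropy, crux `PeaThreeNotInP` (stmt-PneNP-10776), line `SketchIdeator3`, lattice client:
# the carry automaton is tabulated in polynomial time (stub `stub_affineFP`)

The socket client `lattice-cube-smoothing` presents the output bits of its samplers as the carry
automata `affineBitRaw cs j` (`SzkEntropyPeaThreeNotInPSocketAffineBit`): a CLOSED-FORM raw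
branching program, the two sinks followed by the `L = (j + 1) · N · (2N + 3)` flow states in
decreasing flow number, each node obtained from its flow number `φ` by index arithmetic
(`affineNode`, `affineSucc`, `affineIdx`). This file proves that the tabulation
`(cs, 1ʲ) ↦ affineBitRaw cs j` is typed polynomial time (`stub_affineFP`), `j` in UNARY, so that
`L` is polynomial in the input length.

The program is assembled from the typed combinators of the `CodeFP` kit: the unary budget of `L`
units is a product of unit lists (`unitsMul`), the flow numbers are `urange` of it, reversed
(`rawReverse`), and the node of a flow number is binary arithmetic (`natDiv`, `natMod`, `natSub`,
comparisons, `ite`), the coefficient `cs.getD k 0` read by `rawGetOr` and its bit `i` by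
`testBitNat`; the node map is `CodeFP.map` with the context `(cs, 1ʲ)`.

## References

* S. Arora, B. Barak, *Computational Complexity: A Modern Approach*, CUP 2009, §1.3 (closure of
  polynomial time under composition and polynomially bounded loops).
* I. Wegener, *Branching programs and binary decision diagrams*, SIAM 2000, §1.1.
-/

namespace Summit.PneNP.PneNP.Cruxes.PeaThreeNotInP.LatticeLine

set_option linter.dupNamespace false -- summit = sub-problem name (D-0017)

open Literature.Computability.Complexity
open CodeFP (natE unE intE pairE rawE listE bitE unitE)
open Summit.PneNP.PneNP.Cruxes.PeaThreeNotInP.SocketBP (affineBitRaw affineNode affineSucc affineIdx affineS affineL)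

namespace AffineFP

/-! ### Arithmetic leaves -/

/-- `(n, i) ↦ n / 2ⁱ mod 2` with BOTH arguments binary (bit `i` of `n`, through `testBitNat`, so
that `2ⁱ` is never formed for a large `i`). [cite: AroraBarak2009, §1.3] -/
theorem afp_divPowModTwo : CodeFP (pairE natE natE) natE (fun p => p.1 / 2 ^ p.2 % 2) :=
  (CodeFP.testBitNat.ite (CodeFP.const _ (1 : ℕ)) (CodeFP.const _ (0 : ℕ))).congr fun p => by
    rw [Nat.testBit_eq_decide_div_mod_eq]
    rcases Nat.mod_two_eq_zero_or_one (p.1 / 2 ^ p.2) with h | h <;> simp [h]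

/-! ### The parameters of the context `(cs, 1ʲ)` -/

/-- `N = |cs|` in binary. [folklore] -/
theorem afp_ctxN : CodeFP (pairE (rawE intE) unE) natE (fun c => c.1.length) :=
  (CodeFP.natLength intE).comp (CodeFP.fst _ _)

/-- `S = 2N + 3` in binary. [folklore] -/
theorem afp_ctxS : CodeFP (pairE (rawE intE) unE) natE (fun c => affineS c.1) :=
  (CodeFP.natAdd.comp ((CodeFP.natMul.comp ((CodeFP.const _ (2 : ℕ)).pair afp_ctxN)).pair
    (CodeFP.const _ (3 : ℕ)))).congr fun _ => rfl

/-- `j` in binary. [folklore] -/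
theorem afp_ctxJ : CodeFP (pairE (rawE intE) unE) natE (fun c => c.2) :=
  (CodeFP.natOfUn.comp (CodeFP.snd _ _)).congr fun _ => rfl

/-- `L = (j + 1) N S` in binary. [folklore] -/
theorem afp_ctxL : CodeFP (pairE (rawE intE) unE) natE (fun c => affineL c.1 c.2) :=
  (CodeFP.natMul.comp ((CodeFP.natMul.comp ((CodeFP.natAdd.comp (afp_ctxJ.pair
    (CodeFP.const _ (1 : ℕ)))).pair afp_ctxN)).pair afp_ctxS)).congr fun _ => rfl

/-- **`L = (j + 1) N S` in UNARY**: a budget of `(j + 1) · (N · (N + N + 3))` units, the product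
(`unitsMul`) of the unit lists of `1ʲ⁺¹`, of `cs`, and of `cs ++ cs ++ [·, ·, ·]`.
[cite: AroraBarak2009, §1.3] -/
theorem afp_unL : CodeFP (pairE (rawE intE) unE) unE (fun c => affineL c.1 c.2) := by
  have hU : CodeFP (pairE (rawE intE) unE) (rawE unitE) (fun c => c.1.map fun _ => ()) :=
    ((CodeFP.map₀ (CodeFP.const intE ())).comp (CodeFP.fst _ _) :)
  have hJ : CodeFP (pairE (rawE intE) unE) (rawE unitE) (fun c => List.replicate (c.2 + 1) ()) :=
    (CodeFP.replicateUnit.comp (CodeFP.unSucc.comp (CodeFP.snd _ _)) :)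
  have hS : CodeFP (pairE (rawE intE) unE) (rawE unitE)
      (fun c => (c.1.map fun _ => ()) ++ ((c.1.map fun _ => ()) ++ [(), (), ()])) :=
    ((CodeFP.rawAppend unitE).comp (hU.pair ((CodeFP.rawAppend unitE).comp
      (hU.pair (CodeFP.const _ [(), (), ()])))) :)
  have hB : CodeFP (pairE (rawE intE) unE) (rawE unitE)
      (fun c => List.replicate ((List.replicate (c.2 + 1) ()).length *
        (List.replicate ((c.1.map fun _ => ()).length *
          ((c.1.map fun _ => ()) ++ ((c.1.map fun _ => ()) ++ [(), (), ()])).length) ()).length) ()) :=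
    (CodeFP.unitsMul.comp (hJ.pair (CodeFP.unitsMul.comp (hU.pair hS))) :)
  refine ((CodeFP.ulength unitE).comp hB).congr fun c => ?_
  simp only [List.length_replicate, List.length_append, List.length_map, List.length_cons,
    List.length_nil, affineL, affineS]
  ring

/-! ### The node of a flow state -/

/-- **The node index `affineIdx cs j q s`** on codes (argument `((cs, 1ʲ), q, s)`).
[cite: AroraBarak2009, §1.3] -/
theorem afp_idxFP : CodeFP (pairE (pairE (rawE intE) unE) (pairE natE natE)) natE
    (fun t => affineIdx t.1.1 t.1.2 t.2.1 t.2.2) := by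
  have hL : CodeFP (pairE (pairE (rawE intE) unE) (pairE natE natE)) natE
      (fun t => affineL t.1.1 t.1.2) := (afp_ctxL.comp (CodeFP.fst _ _) :)
  have hS : CodeFP (pairE (pairE (rawE intE) unE) (pairE natE natE)) natE
      (fun t => affineS t.1.1) := (afp_ctxS.comp (CodeFP.fst _ _) :)
  have hQ : CodeFP (pairE (pairE (rawE intE) unE) (pairE natE natE)) natE (fun t => t.2.1) :=
    (CodeFP.snd _ _).fst'
  have hs : CodeFP (pairE (pairE (rawE intE) unE) (pairE natE natE)) natE (fun t => t.2.2) :=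
    (CodeFP.snd _ _).snd'
  exact (CodeFP.natSub.comp ((CodeFP.natAdd.comp (hL.pair (CodeFP.const _ (1 : ℕ)))).pair
    (CodeFP.natAdd.comp ((CodeFP.natMul.comp (hQ.pair hS)).pair hs)))).congr fun _ => rfl

/-- **The successor index `affineSucc cs j i k s`** on codes (argument `((cs, 1ʲ), i, k, s)`).
[cite: AroraBarak2009, §1.3] -/
theorem afp_succFP : CodeFP (pairE (pairE (rawE intE) unE) (pairE natE (pairE natE natE))) natE
    (fun t => affineSucc t.1.1 t.1.2 t.2.1 t.2.2.1 t.2.2.2) := by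
  let aE := pairE (pairE (rawE intE) unE) (pairE natE (pairE natE natE))
  have hC : CodeFP aE (pairE (rawE intE) unE) (fun t => t.1) := CodeFP.fst _ _
  have hN : CodeFP aE natE (fun t => t.1.1.length) := (afp_ctxN.comp hC :)
  have hJ : CodeFP aE natE (fun t => t.1.2) := (afp_ctxJ.comp hC :)
  have hI : CodeFP aE natE (fun t => t.2.1) := (CodeFP.snd _ _).fst'
  have hK : CodeFP aE natE (fun t => t.2.2.1) := (CodeFP.snd _ _).snd'.fst'
  have hs : CodeFP aE natE (fun t => t.2.2.2) := (CodeFP.snd _ _).snd'.snd'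
  -- the three branches
  have h1 : CodeFP aE natE
      (fun t => affineIdx t.1.1 t.1.2 (t.2.1 * t.1.1.length + t.2.2.1 + 1) t.2.2.2) :=
    (afp_idxFP.comp (hC.pair ((CodeFP.natAdd.comp ((CodeFP.natAdd.comp ((CodeFP.natMul.comp
      (hI.pair hN)).pair hK)).pair (CodeFP.const _ (1 : ℕ)))).pair hs)) :)
  have h2 : CodeFP aE natE
      (fun t => affineIdx t.1.1 t.1.2 ((t.2.1 + 1) * t.1.1.length) (t.2.2.2 / 2)) :=
    (afp_idxFP.comp (hC.pair ((CodeFP.natMul.comp ((CodeFP.natAdd.comp (hI.pair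
      (CodeFP.const _ (1 : ℕ)))).pair hN)).pair (CodeFP.natDiv.comp (hs.pair
        (CodeFP.const _ (2 : ℕ)))))) :)
  have h3 : CodeFP aE natE (fun t => (t.2.2.2 + 1) % 2) :=
    (CodeFP.natMod.comp ((CodeFP.natAdd.comp (hs.pair (CodeFP.const _ (1 : ℕ)))).pair
      (CodeFP.const _ (2 : ℕ))) :)
  have hc1 : CodeFP aE bitE (fun t => decide (t.2.2.1 + 1 < t.1.1.length)) :=
    (CodeFP.natLt.comp ((CodeFP.natAdd.comp (hK.pair (CodeFP.const _ (1 : ℕ)))).pair hN) :)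
  have hc2 : CodeFP aE bitE (fun t => decide (t.2.1 < t.1.2)) := (CodeFP.natLt.comp (hI.pair hJ) :)
  exact (hc1.ite h1 (hc2.ite h2 h3)).congr fun t => by
    simp only [affineSucc, decide_eq_true_eq]

/-- **The node `affineNode cs j i k s`** on codes (argument `((cs, 1ʲ), i, k, s)`): the coefficient
`c_k = cs.getD k 0` is read by `rawGetOr`, its sign by `intLe`, its bit `i` by `testBitNat`.
[cite: AroraBarak2009, §1.3] -/
theorem afp_nodeFP : CodeFP (pairE (pairE (rawE intE) unE) (pairE natE (pairE natE natE)))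
    (pairE natE (pairE natE (pairE natE natE)))
    (fun t => affineNode t.1.1 t.1.2 t.2.1 t.2.2.1 t.2.2.2) := by
  let aE := pairE (pairE (rawE intE) unE) (pairE natE (pairE natE natE))
  have hC : CodeFP aE (pairE (rawE intE) unE) (fun t => t.1) := CodeFP.fst _ _
  have hI : CodeFP aE natE (fun t => t.2.1) := (CodeFP.snd _ _).fst'
  have hK : CodeFP aE natE (fun t => t.2.2.1) := (CodeFP.snd _ _).snd'.fst'
  have hs : CodeFP aE natE (fun t => t.2.2.2) := (CodeFP.snd _ _).snd'.snd'
  have hc : CodeFP aE intE (fun t => t.1.1.getD t.2.2.1 0) :=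
    ((CodeFP.rawGetOr intE).comp ((CodeFP.fst _ _).fst'.pair (hK.pair (CodeFP.const _ (0 : ℤ)))) :)
  have hsign : CodeFP aE bitE (fun t => decide ((0 : ℤ) ≤ t.1.1.getD t.2.2.1 0)) :=
    (CodeFP.intLe.comp ((CodeFP.const _ (0 : ℤ)).pair hc) :)
  have hbit : CodeFP aE natE (fun t => (t.1.1.getD t.2.2.1 0).natAbs / 2 ^ t.2.1 % 2) :=
    (afp_divPowModTwo.comp ((CodeFP.intNatAbs.comp hc).pair hI) :)
  have hlo : CodeFP aE natE (fun t => t.2.2.2 +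
      if (0 : ℤ) ≤ t.1.1.getD t.2.2.1 0 then 0 else (t.1.1.getD t.2.2.1 0).natAbs / 2 ^ t.2.1 % 2) :=
    (CodeFP.natAdd.comp (hs.pair (hsign.ite (CodeFP.const _ (0 : ℕ)) hbit))).congr fun t => by
      simp only [decide_eq_true_eq]
  have hhi : CodeFP aE natE (fun t => t.2.2.2 +
      if (0 : ℤ) ≤ t.1.1.getD t.2.2.1 0 then (t.1.1.getD t.2.2.1 0).natAbs / 2 ^ t.2.1 % 2 else 0) :=
    (CodeFP.natAdd.comp (hs.pair (hsign.ite hbit (CodeFP.const _ (0 : ℕ))))).congr fun t => by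
      simp only [decide_eq_true_eq]
  have hSlo : CodeFP aE natE (fun t => affineSucc t.1.1 t.1.2 t.2.1 t.2.2.1 (t.2.2.2 +
      if (0 : ℤ) ≤ t.1.1.getD t.2.2.1 0 then 0 else (t.1.1.getD t.2.2.1 0).natAbs / 2 ^ t.2.1 % 2)) :=
    (afp_succFP.comp (hC.pair (hI.pair (hK.pair hlo))) :)
  have hShi : CodeFP aE natE (fun t => affineSucc t.1.1 t.1.2 t.2.1 t.2.2.1 (t.2.2.2 +
      if (0 : ℤ) ≤ t.1.1.getD t.2.2.1 0 then (t.1.1.getD t.2.2.1 0).natAbs / 2 ^ t.2.1 % 2 else 0)) :=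
    (afp_succFP.comp (hC.pair (hI.pair (hK.pair hhi))) :)
  exact ((CodeFP.const _ (2 : ℕ)).pair (hK.pair (hSlo.pair hShi))).congr fun _ => rfl

/-- **The node of flow number `φ`** on codes (argument `((cs, 1ʲ), φ)`): `i = φ / S / N`,
`k = φ / S mod N`, `s = φ mod S`. [cite: AroraBarak2009, §1.3] -/
theorem afp_itemFP : CodeFP (pairE (pairE (rawE intE) unE) natE)
    (pairE natE (pairE natE (pairE natE natE)))
    (fun t => affineNode t.1.1 t.1.2 (t.2 / affineS t.1.1 / t.1.1.length)
      (t.2 / affineS t.1.1 % t.1.1.length) (t.2 % affineS t.1.1)) := by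
  let aE := pairE (pairE (rawE intE) unE) natE
  have hC : CodeFP aE (pairE (rawE intE) unE) (fun t => t.1) := CodeFP.fst _ _
  have hN : CodeFP aE natE (fun t => t.1.1.length) := (afp_ctxN.comp hC :)
  have hS : CodeFP aE natE (fun t => affineS t.1.1) := (afp_ctxS.comp hC :)
  have hq : CodeFP aE natE (fun t => t.2 / affineS t.1.1) :=
    (CodeFP.natDiv.comp ((CodeFP.snd _ _).pair hS) :)
  have hi : CodeFP aE natE (fun t => t.2 / affineS t.1.1 / t.1.1.length) :=
    (CodeFP.natDiv.comp (hq.pair hN) :)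
  have hk : CodeFP aE natE (fun t => t.2 / affineS t.1.1 % t.1.1.length) :=
    (CodeFP.natMod.comp (hq.pair hN) :)
  have hs : CodeFP aE natE (fun t => t.2 % affineS t.1.1) :=
    (CodeFP.natMod.comp ((CodeFP.snd _ _).pair hS) :)
  exact (afp_nodeFP.comp (hC.pair (hi.pair (hk.pair hs)))).congr fun _ => rfl

end AffineFP

/-- **(W7) The carry automaton is tabulated in polynomial time**: `(cs, 1ʲ) ↦ affineBitRaw cs j`
(closed-form node list of length `(j+1) N (2N+3) + 2`, entries by index arithmetic; `j` in UNARY).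
[cite: AroraBarak2009, §1.3] -/
theorem stub_affineFP : CodeFP (pairE (rawE intE) unE) (rawE (pairE natE (pairE natE (pairE natE natE)))) (fun p => affineBitRaw p.1 p.2) := by
  have hR : CodeFP (pairE (rawE intE) unE) (rawE natE)
      (fun c => (List.range (affineL c.1 c.2)).reverse) :=
    ((CodeFP.rawReverse natE).comp (CodeFP.urange.comp AffineFP.afp_unL) :)
  have hM : CodeFP (pairE (rawE intE) unE) (rawE (pairE natE (pairE natE (pairE natE natE))))
      (fun c => (List.range (affineL c.1 c.2)).reverse.map fun φ =>
        affineNode c.1 c.2 (φ / affineS c.1 / c.1.length) (φ / affineS c.1 % c.1.length)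
          (φ % affineS c.1)) :=
    ((CodeFP.map AffineFP.afp_itemFP).comp ((CodeFP.id _).pair hR) :)
  exact ((CodeFP.rawAppend _).comp ((CodeFP.const _ [(1, 0, 0, 0), (0, 0, 0, 0)]).pair hM)).congr
    fun _ => rfl

end Summit.PneNP.PneNP.Cruxes.PeaThreeNotInP.LatticeLine
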